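import Summits.HubbardSuperconductivity.HubbardSuperconductivity.Theorems.AposterioriCapRgSsbToEvenTorusLroFacePurityOfGcRepelledChord
import HarnessLib

/-!
# Crux `CwSsbToEvenTorusLRO` (stmt-HubbardSuperconductivity-10439, route `ChiralWindow`), line `griffiths-block-slope` —
# the split glue, stated WITHOUT importing `Theses.ChiralWindow`

The registered skeleton (`Cruxes/CwSsbToEvenTorusLRO/Lines/griffiths_block_slope.lean`, v4.2) has exactly two open stubs:
S2' `stub_sourceFreeBlockSlopeFloor` (thermodynamic: source-free grand-canonical repelled block-chord floor, "GRC") and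
S7 `stub_infraredLeak` (infrared: guarded weak-coupling pointwise leak of the `d`-wave pair structure factor). Their
composition into the crux is landed (`cwSsbToEvenTorusLRO_of_slopeFloor_of_infraredLeak`, p106548) — but in a module that imports
`Theses.ChiralWindow`, so a route edit that SPLITS the crux into the two stubs (strategist's package
`Cruxes/CwSsbToEvenTorusLRO/SPLIT-PACKAGE.md`) cannot cite it with `--glue-by` (import cycle) and would have to file a generated
glue item. This helper file removes that obstacle: it restates the same composition with the crux's BODY as the conclusion
(word for word the body of `Theses.ChiralWindow.CwSsbToEvenTorusLRO`, fully qualified) in a module whose imports reach only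
`Theses.WeakCouplingBCS` / `Theses.KacWindowPenalty` / `Theses.AposterioriCapRg` (through the sibling lead's landed
`AposterioriCapRgSsbToEvenTorusLroFacePurityOfGcRepelledChord`), never `Theses.ChiralWindow`. In the route file,
`theorem CwSsbToEvenTorusLROGlue : CwGcRepelledChordFloor → CwInfraredLeak → CwSsbToEvenTorusLRO := splitGlue_of_gcRepelledChordFloor_of_infraredLeak`
then elaborates by unfolding three `def`s (checked in the strategist's scratch `SplitCheck.lean` for the cyclic twin).

* `splitGlue_of_gcRepelledChordFloor_of_infraredLeak` — `C₁ → C₂ → (crux body)`, `U₀ :=` the smaller threshold; pointwise it is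
  the sibling's `fp_chord_of_gcRepelledChordAt` followed by the twin's `deriv_of_chord` → `floor_of_deriv_of_leak` →
  `hasDWavePairFieldLROAt_of_floor` (the chain of the landed `hasDWavePairFieldLROAt_of_slopeFloorAt`, inlined — that lemma lives in
  the cyclic module and is not re-declared here);
* `splitGlue_of_gcRepelledChordFloor_of_windowInfraredBound` — `C₁ → (body of KacWindowPenalty.WindowInfraredBound, item
  stmt-HubbardSuperconductivity-1089) → (crux body)`, for the alternative family {C₁, stmt-1089}.

Proposed `--supports stmt-HubbardSuperconductivity-10439` (lead c6). No definition, no new mathematics: [folklore] bookkeeping over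
landed theorems (Tasaki 2020 §2.1 variational principle; Koma–Tasaki 1994 §1 for the objects).
Notation in docstrings: `K_μ = hubbardTorusWith 2 L 1 U μ`, `W_R = R⁻⁴ Σ_a B_aᴴ B_a`, `B_a = Σ_{u ∈ [0,R)²} P_{a+u}`,
`P_x = localPair dWaveFormFactor L x`, `E₀ = Matrix.groundEnergy`, `S_ψ(m) = pairStructureFactor dWaveFormFactor L ψ m`.
-/

noncomputable section

set_option linter.dupNamespace false

namespace Summit.HubbardSuperconductivity.HubbardSuperconductivity.Theorems.CwSsbToEvenTorusLRO

open Literature.MathematicalPhysics.QuantumLattice Literature.Barriers.HubbardSuperconductivity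
open Summit.HubbardSuperconductivity.WcbcsSsbToTorusLRO.Negative
open Filter Set Matrix
open scoped Matrix ComplexOrder BigOperators
open _root_.Topology

/-- **SPLIT GLUE `C₁ → C₂ → crux` (sorry-free, `Theses.ChiralWindow`-free; the `--glue-by` target).** The guarded GRC floor
(child `CwGcRepelledChordFloor` = stub S2' verbatim) and the guarded weak-coupling infrared leak (child `CwInfraredLeak` = stub S7
verbatim) imply the BODY of `Theses.ChiralWindow.CwSsbToEvenTorusLRO` (stated word for word; `U₀ :=` the minimum of the two
thresholds). [folklore] -/
theorem splitGlue_of_gcRepelledChordFloor_of_infraredLeak : (∃ U₀ : ℝ, 0 < U₀ ∧ ∀ U ∈ Set.Ioo (0:ℝ) U₀, ∀ δ ∈ Set.Ioo (0:ℝ) (1 / 2), ∀ μ : ℝ, Filter.Tendsto (fun L : ℕ => ((Literature.MathematicalPhysics.QuantumLattice.hubbardTorusWith 2 (L + 1) 1 U μ).groundStateFunctional Literature.MathematicalPhysics.QuantumLattice.totalNumber).re / ((L + 1 : ℕ) : ℝ) ^ 2) Filter.atTop (nhds (1 - δ)) → Literature.MathematicalPhysics.QuantumLattice.HasDWaveOrder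 U μ → ∃ a : ℝ, 0 < a ∧ ∀ R : ℕ, 0 < R → ∃ κ : ℝ, 0 < κ ∧ ∀ᶠ k : ℕ in Filter.atTop, κ * a * ((2 * k + 1 + 1 : ℕ) : ℝ) ^ 2 ≤ (Literature.MathematicalPhysics.QuantumLattice.hubbardTorusWith 2 (2 * k + 1 + 1) 1 U μ + (κ : ℂ) • (((((R : ℝ) ^ 4)⁻¹ : ℝ) : ℂ) • ∑ a : Literature.Probability.LatticeModels.TorusSite 2 (2 * k + 1 + 1), (∑ u : Fin 2 → Fin R, Literature.MathematicalPhysics.QuantumLattice.localPair Literature.MathematicalPhysics.QuantumLattice.dWaveFormFactor (2 * k + 1 + 1) (a + fun i => ((u i : ℕ) : ZMod (2 * k + 1 + 1))))ᴴ * (∑ u : Fin 2 → Fin R, Literature.MathematicalPhysics.QuantumLattice.localPair Literature.MathematicalPhysics.QuantumLattice.dWaveFormFactor (2 * k + 1 + 1) (a + fun i => ((u i : ℕ) : ZMod (2 * k + 1 + 1)))))).groundEnergy - (Literature.MathematicalPhysics.QuantumLattice.hubbardTorusWith 2 (2 * k + 1 + 1) 1 U μ).groundEnergy) → (∃ U₀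 : ℝ, 0 < U₀ ∧ ∀ U ∈ Set.Ioo (0:ℝ) U₀, ∀ δ ∈ Set.Ioo (0:ℝ) (1 / 2), ∀ μ : ℝ, Filter.Tendsto (fun L : ℕ => ((Literature.MathematicalPhysics.QuantumLattice.hubbardTorusWith 2 (L + 1) 1 U μ).groundStateFunctional Literature.MathematicalPhysics.QuantumLattice.totalNumber).re / ((L + 1 : ℕ) : ℝ) ^ 2) Filter.atTop (nhds (1 - δ)) → Literature.MathematicalPhysics.QuantumLattice.HasDWaveOrder U μ → ∀ b : ℝ, 0 < b → ∃ η : ℝ, 0 < η ∧ ∀ᶠ k : ℕ in Filter.atTop, ∀ ψ : Literature.MathematicalPhysics.QuantumLattice.Fock (Literature.MathematicalPhysics.QuantumLattice.Orb (Literature.MathematicalPhysics.QuantumLattice.FermionTorus 2 (2 * k + 1 + 1))), Literature.MathematicalPhysics.QuantumLattice.IsGroundStateInSector (Literature.MathematicalPhysics.QuantumLattice.hubbardTorus 2 (2 * k + 1 + 1) 1 U) (2 * ⌊(1 - δ) * ((2 * k + 1 + 1 : ℕ) : ℝ) ^ 2 / 2⌋₊) 0 ψ → star ψ ⬝ᵥ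 ψ = 1 → (∑ m ∈ (Finset.univ.filter fun m : Literature.Probability.LatticeModels.TorusSite 2 (2 * k + 1 + 1) => m ≠ 0 ∧ Literature.MathematicalPhysics.QuantumLattice.momentumNormSq (2 * k + 1 + 1) m < η ^ 2), Literature.MathematicalPhysics.QuantumLattice.pairStructureFactor Literature.MathematicalPhysics.QuantumLattice.dWaveFormFactor (2 * k + 1 + 1) ψ m) / ((2 * k + 1 + 1 : ℕ) : ℝ) ^ 2 ≤ b) → (∃ U₀ : ℝ, 0 < U₀ ∧ ∀ U ∈ Set.Ioo (0:ℝ) U₀, ∀ δ ∈ Set.Ioo (0:ℝ) (1 / 2), ∀ μ : ℝ, Filter.Tendsto (fun L : ℕ => ((Literature.MathematicalPhysics.QuantumLattice.hubbardTorusWith 2 (L + 1) 1 U μ).groundStateFunctional Literature.MathematicalPhysics.QuantumLattice.totalNumber).re / ((L + 1 : ℕ) : ℝ) ^ 2) Filter.atTop (nhds (1 - δ)) → Literature.MathematicalPhysics.QuantumLattice.HasDWaveOrder U μ → ∀ (N : ℕ → ℕ) (ψ : ∀ L, Literature.MathematicalPhysics.QuantumLattice.Fock (Literature.MathematicalPhysics.QuantumLattice.Orb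 (Literature.MathematicalPhysics.QuantumLattice.FermionTorus 2 L))), (∀ L, Even L → N L = 2 * ⌊(1 - δ) * (L : ℝ) ^ 2 / 2⌋₊ ∧ star (ψ L) ⬝ᵥ ψ L = 1 ∧ Literature.MathematicalPhysics.QuantumLattice.IsGroundStateInSector (Literature.MathematicalPhysics.QuantumLattice.hubbardTorus 2 L 1 U) (N L) 0 (ψ L)) → Literature.Probability.LatticeModels.HasLongRangeOrder (fun k => Literature.Probability.LatticeModels.halfOpenBox 2 (2 * k)) (fun k => Literature.MathematicalPhysics.QuantumLattice.torusPullback (Literature.MathematicalPhysics.QuantumLattice.pairFieldCorr Literature.MathematicalPhysics.QuantumLattice.dWaveFormFactor ψ) (2 * k))) := by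
  intro hS hIR
  obtain ⟨U₁, hU₁, hS⟩ := hS
  obtain ⟨U₂, hU₂, hIR⟩ := hIR
  refine ⟨min U₁ U₂, lt_min hU₁ hU₂, fun U hU δ hδ μ hdm hord => ?_⟩
  have hU1 : U ∈ Set.Ioo (0:ℝ) U₁ := ⟨hU.1, lt_of_lt_of_le hU.2 (min_le_left _ _)⟩
  have hU2 : U ∈ Set.Ioo (0:ℝ) U₂ := ⟨hU.1, lt_of_lt_of_le hU.2 (min_le_right _ _)⟩
  exact hasDWavePairFieldLROAt_of_floor (floor_of_deriv_of_leak
    (deriv_of_chord (fp_chord_of_gcRepelledChordAt ⟨hδ.1, by linarith [hδ.2]⟩ hdm (hS U hU1 δ hδ μ hdm hord)))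
    (hIR U hU2 δ hδ μ hdm hord))

/-- **SPLIT GLUE, family {C₁, stmt-1089} (sorry-free, `Theses.ChiralWindow`-free).** The guarded GRC floor and the BODY of item
stmt-HubbardSuperconductivity-1089 `KacWindowPenalty.WindowInfraredBound` (named here through the route module `Theses.KacWindowPenalty`,
which this module reaches without `Theses.ChiralWindow`) imply the body of `Theses.ChiralWindow.CwSsbToEvenTorusLRO`
(twin's landed `leak_of_windowInfraredBound`). [folklore] -/
theorem splitGlue_of_gcRepelledChordFloor_of_windowInfraredBound : (∃ U₀ : ℝ, 0 < U₀ ∧ ∀ U ∈ Set.Ioo (0:ℝ) U₀, ∀ δ ∈ Set.Ioo (0:ℝ) (1 / 2), ∀ μ : ℝ, Filter.Tendsto (fun L : ℕ => ((Literature.MathematicalPhysics.QuantumLattice.hubbardTorusWith 2 (L + 1) 1 U μ).groundStateFunctional Literature.MathematicalPhysics.QuantumLattice.totalNumber).re / ((L + 1 : ℕ) : ℝ) ^ 2) Filter.atTop (nhds (1 - δ)) → Literature.MathematicalPhysics.QuantumLattice.HasDWaveOrder U μ → ∃ a : ℝ, 0 < a ∧ ∀ R : ℕ, 0 < R → ∃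 κ : ℝ, 0 < κ ∧ ∀ᶠ k : ℕ in Filter.atTop, κ * a * ((2 * k + 1 + 1 : ℕ) : ℝ) ^ 2 ≤ (Literature.MathematicalPhysics.QuantumLattice.hubbardTorusWith 2 (2 * k + 1 + 1) 1 U μ + (κ : ℂ) • (((((R : ℝ) ^ 4)⁻¹ : ℝ) : ℂ) • ∑ a : Literature.Probability.LatticeModels.TorusSite 2 (2 * k + 1 + 1), (∑ u : Fin 2 → Fin R, Literature.MathematicalPhysics.QuantumLattice.localPair Literature.MathematicalPhysics.QuantumLattice.dWaveFormFactor (2 * k + 1 + 1) (a + fun i => ((u i : ℕ) : ZMod (2 * k + 1 + 1))))ᴴ * (∑ u : Fin 2 → Fin R, Literature.MathematicalPhysics.QuantumLattice.localPair Literature.MathematicalPhysics.QuantumLattice.dWaveFormFactor (2 * k + 1 + 1) (a + fun i => ((u i : ℕ) : ZMod (2 * k + 1 + 1)))))).groundEnergy - (Literature.MathematicalPhysics.QuantumLattice.hubbardTorusWith 2 (2 * k + 1 + 1) 1 U μ).groundEnergy) → Summit.HubbardSuperconductivity.HubbardSuperconductivity.Theses.KacWindowPenalty.WindowInfraredBound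 → (∃ U₀ : ℝ, 0 < U₀ ∧ ∀ U ∈ Set.Ioo (0:ℝ) U₀, ∀ δ ∈ Set.Ioo (0:ℝ) (1 / 2), ∀ μ : ℝ, Filter.Tendsto (fun L : ℕ => ((Literature.MathematicalPhysics.QuantumLattice.hubbardTorusWith 2 (L + 1) 1 U μ).groundStateFunctional Literature.MathematicalPhysics.QuantumLattice.totalNumber).re / ((L + 1 : ℕ) : ℝ) ^ 2) Filter.atTop (nhds (1 - δ)) → Literature.MathematicalPhysics.QuantumLattice.HasDWaveOrder U μ → ∀ (N : ℕ → ℕ) (ψ : ∀ L, Literature.MathematicalPhysics.QuantumLattice.Fock (Literature.MathematicalPhysics.QuantumLattice.Orb (Literature.MathematicalPhysics.QuantumLattice.FermionTorus 2 L))), (∀ L, Even L → N L = 2 * ⌊(1 - δ) * (L : ℝ) ^ 2 / 2⌋₊ ∧ star (ψ L) ⬝ᵥ ψ L = 1 ∧ Literature.MathematicalPhysics.QuantumLattice.IsGroundStateInSector (Literature.MathematicalPhysics.QuantumLattice.hubbardTorus 2 L 1 U) (N L) 0 (ψ L)) → Literature.Probability.LatticeModels.HasLongRangeOrder (fun k =>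 Literature.Probability.LatticeModels.halfOpenBox 2 (2 * k)) (fun k => Literature.MathematicalPhysics.QuantumLattice.torusPullback (Literature.MathematicalPhysics.QuantumLattice.pairFieldCorr Literature.MathematicalPhysics.QuantumLattice.dWaveFormFactor ψ) (2 * k))) := by
  intro hS hW
  obtain ⟨U₀, hU₀, hS⟩ := hS
  refine ⟨U₀, hU₀, fun U hU δ hδ μ hdm hord => ?_⟩
  exact hasDWavePairFieldLROAt_of_floor (floor_of_deriv_of_leak
    (deriv_of_chord (fp_chord_of_gcRepelledChordAt ⟨hδ.1, by linarith [hδ.2]⟩ hdm (hS U hU δ hδ μ hdm hord)))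
    (leak_of_windowInfraredBound hW hU.1 hδ))


/-! ## ROUTE-LEVEL glue for the strategist's restatement R1 (`Theses.ChiralWindow`-free; STRATEGY-CENSUS §6 R1)

A rev-3 deciding theorem `closes` of route ChiralWindow must elaborate WITH the route file, so it can only cite constants of
modules the route file may import — nothing that imports `Theses.ChiralWindow`. The landed `cwThesis_of_slopeConstruction`
/ `cwThesis_of_repelledConstruction` (p100695) live in such a cyclic module and conclude `CwThesis` BY NAME. Below, the same
statements with the BODY of `Theses.ChiralWindow.CwThesis` (word for word, fully qualified) as conclusion and the hypotheses
spelled as the closed `Prop`s a planner files as items, so that e.g.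
`theorem closes : CwSlopeChiralConstruction → CwWeakCouplingInfraredLeak → CwKLChiralWindow → Assembly → HubbardSuperconductivity :=
  fun hC hIR _ hA => hA (cwThesisBody_of_slopeConstruction_of_weakCouplingLeak hC hIR)` elaborates in the route file once it imports
this module (defs unfold). Three infrared inputs are offered: item stmt-1089 by name (`∀U`), and the UNGUARDED weak-coupling leak
`CwWeakCouplingInfraredLeak := ∃ U₀ : ℝ, 0 < U₀ ∧ ∀ U ∈ Set.Ioo (0:ℝ) U₀, ∀ δ ∈ Set.Ioo (0:…` (S7 without the `μ`-guard; the strategist's "preferable, no ∀U exposure"). -/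

/-- **R1 glue, family {slope construction, stmt-1089} (sorry-free).** If the chiral construction certifies, at every weak `U`, a window
point `(δ_U, μ_U)`, `δ_U ∈ [3/10, 12/25]`, with density matching AND the grand-canonical repelled block-chord floor at `(U, μ_U)` (a difference
of two ground-state energy densities of `U(1)`-invariant finite-range Hamiltonians), then item stmt-1089 `KacWindowPenalty.WindowInfraredBound`
gives the BODY of `ChiralWindow.CwThesis`. [folklore] -/
theorem cwThesisBody_of_slopeConstruction_of_windowInfraredBound : (∃ U₀ : ℝ, 0 < U₀ ∧ ∀ U ∈ Set.Ioo (0:ℝ) U₀, ∃ δ ∈ Set.Icc (3/10 : ℝ) (12/25), ∃ μ : ℝ, (Filter.Tendsto (fun L : ℕ => ((Literature.MathematicalPhysics.QuantumLattice.hubbardTorusWith 2 (L + 1) 1 U μ).groundStateFunctional Literature.MathematicalPhysics.QuantumLattice.totalNumber).re / ((L + 1 : ℕ) : ℝ) ^ 2) Filter.atTop (nhds (1 - δ))) ∧ ∃ a : ℝ, 0 < a ∧ ∀ R : ℕ, 0 < R → ∃ κ : ℝ, 0 < κ ∧ ∀ᶠ k : ℕ in Filter.atTop, κ * a * ((2 *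 k + 1 + 1 : ℕ) : ℝ) ^ 2 ≤ (Literature.MathematicalPhysics.QuantumLattice.hubbardTorusWith 2 (2 * k + 1 + 1) 1 U μ + (κ : ℂ) • (((((R : ℝ) ^ 4)⁻¹ : ℝ) : ℂ) • ∑ a : Literature.Probability.LatticeModels.TorusSite 2 (2 * k + 1 + 1), (∑ u : Fin 2 → Fin R, Literature.MathematicalPhysics.QuantumLattice.localPair Literature.MathematicalPhysics.QuantumLattice.dWaveFormFactor (2 * k + 1 + 1) (a + fun i => ((u i : ℕ) : ZMod (2 * k + 1 + 1))))ᴴ * (∑ u : Fin 2 → Fin R, Literature.MathematicalPhysics.QuantumLattice.localPair Literature.MathematicalPhysics.QuantumLattice.dWaveFormFactor (2 * k + 1 + 1) (a + fun i => ((u i : ℕ) : ZMod (2 * k + 1 + 1)))))).groundEnergy - (Literature.MathematicalPhysics.QuantumLattice.hubbardTorusWith 2 (2 * k + 1 + 1) 1 U μ).groundEnergy) → Summit.HubbardSuperconductivity.HubbardSuperconductivity.Theses.KacWindowPenalty.WindowInfraredBound → (∃ U₀ : ℝ, 0 < U₀ ∧ ∀ U ∈ Set.Ioo (0:ℝ)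 U₀, ∃ δ ∈ Set.Icc (3/10 : ℝ) (12/25), ∀ (N : ℕ → ℕ) (ψ : ∀ L, Literature.MathematicalPhysics.QuantumLattice.Fock (Literature.MathematicalPhysics.QuantumLattice.Orb (Literature.MathematicalPhysics.QuantumLattice.FermionTorus 2 L))), (∀ L, Even L → N L = 2 * ⌊(1 - δ) * (L : ℝ) ^ 2 / 2⌋₊ ∧ star (ψ L) ⬝ᵥ ψ L = 1 ∧ Literature.MathematicalPhysics.QuantumLattice.IsGroundStateInSector (Literature.MathematicalPhysics.QuantumLattice.hubbardTorus 2 L 1 U) (N L) 0 (ψ L)) → Literature.Probability.LatticeModels.HasLongRangeOrder (fun k => Literature.Probability.LatticeModels.halfOpenBox 2 (2 * k)) (fun k => Literature.MathematicalPhysics.QuantumLattice.torusPullback (Literature.MathematicalPhysics.QuantumLattice.pairFieldCorr Literature.MathematicalPhysics.QuantumLattice.dWaveFormFactor ψ) (2 * k))) := by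
  intro hC hW
  obtain ⟨U₀, hU₀, hC⟩ := hC
  refine ⟨U₀, hU₀, fun U hU => ?_⟩
  obtain ⟨δ, hδ, μ, hdm, hS⟩ := hC U hU
  have hδ' : δ ∈ Set.Ioo (0:ℝ) (1 / 2) := ⟨by linarith [hδ.1], by linarith [hδ.2]⟩
  exact ⟨δ, hδ, hasDWavePairFieldLROAt_of_floor (floor_of_deriv_of_leak
    (deriv_of_chord (fp_chord_of_gcRepelledChordAt ⟨hδ'.1, by linarith [hδ'.2]⟩ hdm hS)) (leak_of_windowInfraredBound hW hU.1 hδ'))⟩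

/-- **R1 glue, family {slope construction, weak-coupling leak} (sorry-free; no `∀U` exposure).** The same construction clause and the
UNGUARDED weak-coupling infrared leak (`∃ U₀ > 0, ∀ U < U₀, ∀ δ ∈ (0, 1/2)`, every normalised sector ground state leaks at most `b` below
momentum radius `η(b)`, eventually along the even sides) give the BODY of `ChiralWindow.CwThesis`, with `U₀ :=` the smaller threshold. [folklore] -/
theorem cwThesisBody_of_slopeConstruction_of_weakCouplingLeak : (∃ U₀ : ℝ, 0 < U₀ ∧ ∀ U ∈ Set.Ioo (0:ℝ) U₀, ∃ δ ∈ Set.Icc (3/10 : ℝ) (12/25), ∃ μ : ℝ, (Filter.Tendsto (fun L : ℕ => ((Literature.MathematicalPhysics.QuantumLattice.hubbardTorusWith 2 (L + 1) 1 U μ).groundStateFunctional Literature.MathematicalPhysics.QuantumLattice.totalNumber).re / ((L + 1 : ℕ) : ℝ) ^ 2) Filter.atTop (nhds (1 - δ))) ∧ ∃ a : ℝ, 0 < a ∧ ∀ R : ℕ, 0 < R → ∃ κ : ℝ, 0 < κ ∧ ∀ᶠ k : ℕ in Filter.atTop, κ * a * ((2 * k + 1 + 1 : ℕ) : ℝ)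 ^ 2 ≤ (Literature.MathematicalPhysics.QuantumLattice.hubbardTorusWith 2 (2 * k + 1 + 1) 1 U μ + (κ : ℂ) • (((((R : ℝ) ^ 4)⁻¹ : ℝ) : ℂ) • ∑ a : Literature.Probability.LatticeModels.TorusSite 2 (2 * k + 1 + 1), (∑ u : Fin 2 → Fin R, Literature.MathematicalPhysics.QuantumLattice.localPair Literature.MathematicalPhysics.QuantumLattice.dWaveFormFactor (2 * k + 1 + 1) (a + fun i => ((u i : ℕ) : ZMod (2 * k + 1 + 1))))ᴴ * (∑ u : Fin 2 → Fin R, Literature.MathematicalPhysics.QuantumLattice.localPair Literature.MathematicalPhysics.QuantumLattice.dWaveFormFactor (2 * k + 1 + 1) (a + fun i => ((u i : ℕ) : ZMod (2 * k + 1 + 1)))))).groundEnergy - (Literature.MathematicalPhysics.QuantumLattice.hubbardTorusWith 2 (2 * k + 1 + 1) 1 U μ).groundEnergy) → (∃ U₀ : ℝ, 0 < U₀ ∧ ∀ U ∈ Set.Ioo (0:ℝ) U₀, ∀ δ ∈ Set.Ioo (0:ℝ) (1 / 2), ∀ b : ℝ, 0 < b → ∃ η : ℝ, 0 < η ∧ ∀ᶠ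 k : ℕ in Filter.atTop, ∀ ψ : Literature.MathematicalPhysics.QuantumLattice.Fock (Literature.MathematicalPhysics.QuantumLattice.Orb (Literature.MathematicalPhysics.QuantumLattice.FermionTorus 2 (2 * k + 1 + 1))), Literature.MathematicalPhysics.QuantumLattice.IsGroundStateInSector (Literature.MathematicalPhysics.QuantumLattice.hubbardTorus 2 (2 * k + 1 + 1) 1 U) (2 * ⌊(1 - δ) * ((2 * k + 1 + 1 : ℕ) : ℝ) ^ 2 / 2⌋₊) 0 ψ → star ψ ⬝ᵥ ψ = 1 → (∑ m ∈ (Finset.univ.filter fun m : Literature.Probability.LatticeModels.TorusSite 2 (2 * k + 1 + 1) => m ≠ 0 ∧ Literature.MathematicalPhysics.QuantumLattice.momentumNormSq (2 * k + 1 + 1) m < η ^ 2), Literature.MathematicalPhysics.QuantumLattice.pairStructureFactor Literature.MathematicalPhysics.QuantumLattice.dWaveFormFactor (2 * k + 1 + 1) ψ m) / ((2 * k + 1 + 1 : ℕ) : ℝ) ^ 2 ≤ b) → (∃ U₀ : ℝ, 0 < U₀ ∧ ∀ U ∈ Set.Ioo (0:ℝ) U₀, ∃ δ ∈ Set.Icc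 (3/10 : ℝ) (12/25), ∀ (N : ℕ → ℕ) (ψ : ∀ L, Literature.MathematicalPhysics.QuantumLattice.Fock (Literature.MathematicalPhysics.QuantumLattice.Orb (Literature.MathematicalPhysics.QuantumLattice.FermionTorus 2 L))), (∀ L, Even L → N L = 2 * ⌊(1 - δ) * (L : ℝ) ^ 2 / 2⌋₊ ∧ star (ψ L) ⬝ᵥ ψ L = 1 ∧ Literature.MathematicalPhysics.QuantumLattice.IsGroundStateInSector (Literature.MathematicalPhysics.QuantumLattice.hubbardTorus 2 L 1 U) (N L) 0 (ψ L)) → Literature.Probability.LatticeModels.HasLongRangeOrder (fun k => Literature.Probability.LatticeModels.halfOpenBox 2 (2 * k)) (fun k => Literature.MathematicalPhysics.QuantumLattice.torusPullback (Literature.MathematicalPhysics.QuantumLattice.pairFieldCorr Literature.MathematicalPhysics.QuantumLattice.dWaveFormFactor ψ) (2 * k))) := by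
  intro hC hIR
  obtain ⟨U₁, hU₁, hC⟩ := hC
  obtain ⟨U₂, hU₂, hIR⟩ := hIR
  refine ⟨min U₁ U₂, lt_min hU₁ hU₂, fun U hU => ?_⟩
  have hU1 : U ∈ Set.Ioo (0:ℝ) U₁ := ⟨hU.1, lt_of_lt_of_le hU.2 (min_le_left _ _)⟩
  have hU2 : U ∈ Set.Ioo (0:ℝ) U₂ := ⟨hU.1, lt_of_lt_of_le hU.2 (min_le_right _ _)⟩
  obtain ⟨δ, hδ, μ, hdm, hS⟩ := hC U hU1
  have hδ' : δ ∈ Set.Ioo (0:ℝ) (1 / 2) := ⟨by linarith [hδ.1], by linarith [hδ.2]⟩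
  exact ⟨δ, hδ, hasDWavePairFieldLROAt_of_floor (floor_of_deriv_of_leak
    (deriv_of_chord (fp_chord_of_gcRepelledChordAt ⟨hδ'.1, by linarith [hδ'.2]⟩ hdm hS)) (hIR U hU2 δ hδ'))⟩

/-- **R1 glue, sourced family {repelled construction, stmt-1089} (sorry-free).** The chiral construction run WITH the block term AND the
source (an `R`-uniform repelled Koma–Tasaki order floor at some window `(δ_U, μ_U)` with density matching) plus item stmt-1089 give the BODY of
`ChiralWindow.CwThesis` (through the sibling's `gcRepelledChord_of_repelledOrderAt`). [folklore] -/
theorem cwThesisBody_of_repelledConstruction_of_windowInfraredBound : (∃ U₀ : ℝ, 0 < U₀ ∧ ∀ U ∈ Set.Ioo (0:ℝ) U₀, ∃ δ ∈ Set.Icc (3/10 : ℝ) (12/25), ∃ μ : ℝ, (Filter.Tendsto (fun L : ℕ => ((Literature.MathematicalPhysics.QuantumLattice.hubbardTorusWith 2 (L + 1) 1 U μ).groundStateFunctional Literature.MathematicalPhysics.QuantumLattice.totalNumber).re / ((L + 1 : ℕ) : ℝ) ^ 2) Filter.atTop (nhds (1 - δ))) ∧ ∃ a : ℝ, 0 <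 a ∧ ∀ R : ℕ, 0 < R → ∃ κ : ℝ, 0 < κ ∧ ∃ h₀ : ℝ, 0 < h₀ ∧ ∀ h ∈ Set.Ioo (0:ℝ) h₀, ∀ᶠ L : ℕ in Filter.atTop, a ≤ ((Literature.MathematicalPhysics.QuantumLattice.dWaveSourceTorus (L + 1) U μ h + (κ : ℂ) • (((((R : ℝ) ^ 4)⁻¹ : ℝ) : ℂ) • ∑ a : Literature.Probability.LatticeModels.TorusSite 2 (L + 1), (∑ u : Fin 2 → Fin R, Literature.MathematicalPhysics.QuantumLattice.localPair Literature.MathematicalPhysics.QuantumLattice.dWaveFormFactor (L + 1) (a + fun i => ((u i : ℕ) : ZMod (L + 1))))ᴴ * (∑ u : Fin 2 → Fin R, Literature.MathematicalPhysics.QuantumLattice.localPair Literature.MathematicalPhysics.QuantumLattice.dWaveFormFactor (L + 1) (a + fun i => ((u i : ℕ) : ZMod (L + 1)))))).groundStateFunctional (Literature.MathematicalPhysics.QuantumLattice.pairField Literature.MathematicalPhysics.QuantumLattice.dWaveFormFactor (L + 1))).re / ((L + 1 : ℕ) : ℝ) ^ 2) → Summit.HubbardSuperconductivity.HubbardSuperconductivity.Theses.KacWindowPenalty.WindowInfraredBound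 → (∃ U₀ : ℝ, 0 < U₀ ∧ ∀ U ∈ Set.Ioo (0:ℝ) U₀, ∃ δ ∈ Set.Icc (3/10 : ℝ) (12/25), ∀ (N : ℕ → ℕ) (ψ : ∀ L, Literature.MathematicalPhysics.QuantumLattice.Fock (Literature.MathematicalPhysics.QuantumLattice.Orb (Literature.MathematicalPhysics.QuantumLattice.FermionTorus 2 L))), (∀ L, Even L → N L = 2 * ⌊(1 - δ) * (L : ℝ) ^ 2 / 2⌋₊ ∧ star (ψ L) ⬝ᵥ ψ L = 1 ∧ Literature.MathematicalPhysics.QuantumLattice.IsGroundStateInSector (Literature.MathematicalPhysics.QuantumLattice.hubbardTorus 2 L 1 U) (N L) 0 (ψ L)) → Literature.Probability.LatticeModels.HasLongRangeOrder (fun k => Literature.Probability.LatticeModels.halfOpenBox 2 (2 * k)) (fun k => Literature.MathematicalPhysics.QuantumLattice.torusPullback (Literature.MathematicalPhysics.QuantumLattice.pairFieldCorr Literature.MathematicalPhysics.QuantumLattice.dWaveFormFactor ψ) (2 * k))) := by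
  intro hC hW
  obtain ⟨U₀, hU₀, hC⟩ := hC
  refine ⟨U₀, hU₀, fun U hU => ?_⟩
  obtain ⟨δ, hδ, μ, hdm, hBa⟩ := hC U hU
  have hδ' : δ ∈ Set.Ioo (0:ℝ) (1 / 2) := ⟨by linarith [hδ.1], by linarith [hδ.2]⟩
  exact ⟨δ, hδ, hasDWavePairFieldLROAt_of_floor (floor_of_deriv_of_leak
    (deriv_of_chord (fp_chord_of_gcRepelledChordAt ⟨hδ'.1, by linarith [hδ'.2]⟩ hdm (gcRepelledChord_of_repelledOrderAt hBa)))
    (leak_of_windowInfraredBound hW hU.1 hδ'))⟩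

end Summit.HubbardSuperconductivity.HubbardSuperconductivity.Theorems.CwSsbToEvenTorusLRO

end
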